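import Literature.Computability.AlgebraicComplexity.KV22PowerSumDeterminantalComplexityProofs
import Literature.Computability.AlgebraicComplexity.AndrewsForbes2022DeterminantalIdeals
import HarnessLib

/-!
# Chatterjee–Kumar–She–Volk 2022, Theorem 1.1: a quadratic lower bound for general (layered) ABPs

P. Chatterjee, M. Kumar, A. She, B. L. Volk, *Quadratic lower bounds for algebraic branching programs
and formulas*, comput. complex. **31** (2022) 8 (= CCC 2020, arXiv:1911.11793)
[ChatterjeeKumarSheVolk2022]. Page/line locators `pNNNN` refer to the chunks of the materialised
arXiv text.

**Theorem 1.1** (p0004, `\beginrestatabletheoremmainABP`): "Let `𝔽` be a field and `n ∈ ℕ` such that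
`char(𝔽) ∤ n`. Then any algebraic branching program over `𝔽` computing the polynomial `Σ_{i=1}^n x_i^n`
is of size at least `Ω(n²)`. When the ABP's edge labels are allowed to be polynomials of degree at most
`Δ`, our lower bound is `Ω(n²/Δ)`." Here an ABP is the paper's Definition 1 (p0003): "a layered graph
where each edge is labeled by an affine linear form and the first and the last layer have one vertex
each", computing "the sum of the weights of all paths from the start vertex to the end vertex", of
size "the number of vertices"; this is the tree's `LayeredABPComputes` (Andrews–Forbes rendering:
vertex set `Fin k`, a layer function, an adjacency matrix of labels, computed polynomial
`(N ^ (layer t − layer s)) s t`), and `LayeredABPDegComputes m Δ g` below is its variant "with edge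
labels of degree at most `Δ`" (p0004:L9–L12; `Δ = 1` is `LayeredABPComputes` by `Iff.rfl`).

PROVED here (`chatterjeeKumarSheVolk2022_thm_1_1`) with an explicit constant: if a layered ABP on at
most `m` vertices with edge labels of degree `≤ Δ` computes `Σ_{i<n} x_i^n` over a field with
`(n : K) ≠ 0`, then `n·(⌊n/Δ⌋ − 1) ≤ 18·(m − 2)`; for affine labels (`Δ = 1`,
`chatterjeeKumarSheVolk2022_thm_1_1_affine`) `n(n − 1) ≤ 18(m − 2)`, i.e. `m ≥ 2 + n(n−1)/18 = Ω(n²)`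
(the printed proof gives `0.001·n²/Δ`).

## Proof (follows §3.2, p0010–p0012; the one deviation is flagged)

* The matrix rendering of Def. 1 used throughout (§1.1, p0004:L1–L6: "any polynomial computable by
  an ABP with `d` layers and `ℓ_i` vertices in the `i`-th layer can be written as the (only) entry of
  the `1 × 1` matrix given by the product `M := Π_{i=1}^{d−1} M_i`, where `M_i` is an `ℓ_i × ℓ_{i+1}`
  matrix … the sums of dimensions of the matrices … is the same as the number of vertices"):
  `CKSV2022.Comp` = a chain of `D = d − 1` square matrices `M 0, …, M (D−1)` over an ambient index
  type `Fin k`, with layer supports `S 0 = {s}, S 1, …, S D = {t}` (`M i` supported on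
  `S i × S (i+1)`), computing `(M 0 ⋯ M (D−1)) s t` (`Comp.eval`) with `Σ_{0<i<D} |S i|` internal
  vertices (`Comp.internal`). Def. 5 (multilayered ABP, p0009:L8–L15: ABPs "in parallel … identifying
  their start and end vertices", size `2 + Σ_i (τ_i − 2)`) = a finite family of `Comp`s, computing the
  sum, of size `2 + Σ internal`.
* Lemma 10 with Claim 11 (p0010:L27–p0011:L40): cutting a component at an internal layer `j` with row
  vector `U = [s,u]_u = M_0⋯M_{j−1}` and column `V = [u,t]_u = M_j⋯M_{D−1}`, constant terms `α_u, β_u`,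
  `P_u = [s,u] − α_u`, `Q_u = [u,t] − β_u`:
  `F = Uβ + αV + Σ_u P_u Q_u − Σ_u α_u β_u` (`Comp.eval_cut`), where `Uβ = M_0⋯M_{j−2}(M_{j−1}β)` is a
  layered ABP with `j` layers (`Comp.cutLeft`) and `αV = (αM_j)M_{j+1}⋯M_{D−1}` one with `d − j + 1`
  layers (`Comp.cutRight`) — in the matrix rendering Claim 11 ("the last layer is redundant and can be
  removed" when its edges carry scalars) is the associativity `M_{j−1}·β`, `α·M_j`; together they have
  `|S j|` fewer vertices (`Comp.internal_cut`).
* Lemma 12 / Claim 13 (p0011:L42–p0012:L60): cut every component of depth `> j` at a common middle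
  layer `j ∈ (L/3, 2L/3]` minimising the layer load `ℓ_j` (`CKSV2022.step`); by averaging
  `ℓ_j·(L − 1) ≤ 3·(size − 2)` (`CKSV2022.load_min_bound`) and the new depth `L₁` has `3L₁ ≤ 2L`.
* Proof of Thm. 1.1 (p0012:L1–L37): iterate while the depth allows degree `n` (`L·Δ ≥ n`); the error
  count is a geometric sum (footnote p0006: "a geometric progression with first term roughly `τ/n` and
  common ratio being a constant less than `1`"), carried as the invariant
  `r ≤ 3(size−2)(3/q − 2/(L−1))`, `q = ⌊n/Δ⌋ − 1` (`CKSV2022.depthReduction`).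
* Endgame — DEVIATION (shorter road, same content): the printed proof stops at `≤ n/Δ` layers and
  invokes the robust bound Thm. 7; but a program with `L` matrices of degree `≤ Δ`, `LΔ < n`, computes
  a polynomial of degree `< n`, so at that point the identity
  `Σ x_i^n = Σ_{j<r} P_j Q_j + (F' + δ)`, `deg(F' + δ) < n`, `P_j(0) = Q_j(0) = 0`, is exactly the
  hypothesis of Lemma 8 with `m = 0` (p0009:L40–L60, = [K19, Lemma 3.1] = Kumar–Volk Lemma 4), which is
  the tree's `KumarVolk.width_lemma_zero`: `n ≤ 2r`. (Thm. 7 itself is the tree's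
  `chatterjeeKumarSheVolk2022_thm_7_general`, not needed here.)

Theorems 2 (unlayered ABPs, Valiant's depth-reduction lemma) and 3 (formulas, `ESYM(n, 0.1n)`) of the
paper are NOT typed here. D-0026: no named facts; everything is a definition with a body or a theorem.

## References
* [ChatterjeeKumarSheVolk2022] P. Chatterjee, M. Kumar, A. She, B. L. Volk, comput. complex. 31
  (2022) 8, doi:10.1007/s00037-022-00223-8, arXiv:1911.11793 — Def. 1, Thm. 1.1, Def. 5, Lemma 8,
  Lemma 10, Claim 11, Lemma 12, Claim 13.
* [KumarVolk2022b] M. Kumar, B. L. Volk, comput. complex. 31 (2022) 12 — Lemma 4 (the width lemma,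
  `KumarVolk.width_lemma_zero`).
* [AndrewsForbes2022] R. Andrews, M. A. Forbes, STOC 2022 — the layered-ABP rendering
  `LayeredABPComputes` reused here.
-/

noncomputable section

open MvPolynomial Matrix Finset

namespace Literature.Computability.AlgebraicComplexity

/-! ### Definition 1 with edge labels of degree `≤ Δ` -/

section LayeredDeg

variable {R : Type*} [CommSemiring R] {ι : Type*}

/-- **`g` is computed by a layered ABP on at most `m` vertices with edge labels of degree `≤ Δ`**
(CKSV Def. 1, p0003: "An Algebraic Branching Program (ABP) is a layered graph where each edge is
labeled by an affine linear form and the first and the last layer have one vertex each … The size of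
an ABP is the number of vertices in it", with the variant p0004:L9–L12: "an even more general
definition, which we sometimes adopt, is to allow every edge to be labeled by an arbitrary polynomial
of degree at most `Δ`. In this case we refer to the model as an ABP with edge labels of degree at most
`Δ`"). Rendering = the tree's `LayeredABPComputes` (vertex set `Fin k`, `k ≤ m`, a layer function,
adjacency matrix `N` of labels with every edge going up one layer, computed polynomial
`(N ^ (layer t − layer s)) s t`) with the label bound `1` replaced by `Δ`.
[cite: ChatterjeeKumarSheVolk2022, Definition 1 and §1.1 "Edge labels"] -/
def LayeredABPDegComputes (m Δ : ℕ) (g : MvPolynomial ι R) : Prop :=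
  ∃ (k : ℕ) (_ : k ≤ m) (layer : Fin k → ℕ) (s t : Fin k) (N : Matrix (Fin k) (Fin k) (MvPolynomial ι R)),
    (∀ u v, N u v ≠ 0 → layer v = layer u + 1) ∧ (∀ u v, (N u v).totalDegree ≤ Δ) ∧
      (N ^ (layer t - layer s)) s t = g

/-- Affine labels are the case `Δ = 1` ("the common case is `Δ = 1`", p0004:L12).
[cite: ChatterjeeKumarSheVolk2022, §1.1 "Edge labels"] -/
theorem layeredABPComputes_iff_layeredABPDegComputes_one (m : ℕ) (g : MvPolynomial ι R) :
    LayeredABPComputes m g ↔ LayeredABPDegComputes m 1 g := Iff.rfl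

/-- Monotonicity in the label-degree bound and the vertex budget. [cite: ChatterjeeKumarSheVolk2022, §1.1] -/
theorem LayeredABPDegComputes.mono {m m' Δ Δ' : ℕ} (hm : m ≤ m') (hΔ : Δ ≤ Δ') {g : MvPolynomial ι R}
    (hg : LayeredABPDegComputes m Δ g) : LayeredABPDegComputes m' Δ' g := by
  obtain ⟨k, hk, layer, s, t, N, h1, h2, h3⟩ := hg
  exact ⟨k, hk.trans hm, layer, s, t, N, h1, fun u v => (h2 u v).trans hΔ, h3⟩

end LayeredDeg

namespace CKSV2022

/-! ### Chains of matrices -/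

section ChainProd

variable {V : Type*} [Fintype V] [DecidableEq V] {A : Type*} [Semiring A]

/-- `chainProd M a len = M a * M (a+1) * ⋯ * M (a+len−1)` (the product `Π M_i` of §1.1, p0004:L3).
[cite: ChatterjeeKumarSheVolk2022, §1.1] -/
def chainProd (M : ℕ → Matrix V V A) (a : ℕ) : ℕ → Matrix V V A
  | 0 => 1
  | len + 1 => chainProd M a len * M (a + len)

/-- Unfolding: the empty product of §1.1's `Π M_i` is `1`. [cite: ChatterjeeKumarSheVolk2022, §1.1] -/
@[simp] theorem chainProd_zero (M : ℕ → Matrix V V A) (a : ℕ) : chainProd M a 0 = 1 := rfl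

/-- Unfolding: `Π_{i<len+1} M_i = (Π_{i<len} M_i)·M_len` (§1.1's product). [cite: ChatterjeeKumarSheVolk2022, §1.1] -/
theorem chainProd_succ (M : ℕ → Matrix V V A) (a len : ℕ) :
    chainProd M a (len + 1) = chainProd M a len * M (a + len) := rfl

/-- One factor (§1.1's product with `d = 2` layers). [cite: ChatterjeeKumarSheVolk2022, §1.1] -/
theorem chainProd_one (M : ℕ → Matrix V V A) (a : ℕ) : chainProd M a 1 = M a := by
  rw [chainProd_succ, chainProd_zero, Matrix.one_mul, add_zero]

/-- Splitting §1.1's product at a layer: `Π_{i<l₁+l₂} M_i = (Π_{i<l₁} M_i)(Π_{l₁≤i<l₁+l₂} M_i)` — the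
matrix form of "`[s,t] = Σ_i [s,u_i]·[u_i,t]`" (p0010:L37). [cite: ChatterjeeKumarSheVolk2022, §1.1, Lemma 10] -/
theorem chainProd_add (M : ℕ → Matrix V V A) (a l₁ l₂ : ℕ) :
    chainProd M a (l₁ + l₂) = chainProd M a l₁ * chainProd M (a + l₁) l₂ := by
  induction l₂ with
  | zero => rw [add_zero, chainProd_zero, Matrix.mul_one]
  | succ l ih => rw [← add_assoc, chainProd_succ, ih, chainProd_succ, Matrix.mul_assoc, add_assoc]

/-- First factor out of §1.1's product. [cite: ChatterjeeKumarSheVolk2022, §1.1] -/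
theorem chainProd_succ_left (M : ℕ → Matrix V V A) (a len : ℕ) :
    chainProd M a (len + 1) = M a * chainProd M (a + 1) len := by
  rw [add_comm len 1, chainProd_add, chainProd_one]

/-- §1.1's product only depends on the factors it uses. [cite: ChatterjeeKumarSheVolk2022, §1.1] -/
theorem chainProd_congr {M M' : ℕ → Matrix V V A} {a len : ℕ}
    (h : ∀ i, a ≤ i → i < a + len → M i = M' i) : chainProd M a len = chainProd M' a len := by
  induction len with
  | zero => rfl
  | succ l ih =>
    rw [chainProd_succ, chainProd_succ, ih fun i h1 h2 => h i h1 (by omega),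
      h (a + l) (by omega) (by omega)]

/-- Re-indexing §1.1's product (renumbering the layers `ℓ, ℓ+1, …` of `𝒞` as `2, 3, …`, p0010:L47).
[cite: ChatterjeeKumarSheVolk2022, §1.1, Lemma 10] -/
theorem chainProd_shift (M : ℕ → Matrix V V A) (c a len : ℕ) :
    chainProd (fun i => M (c + i)) a len = chainProd M (c + a) len := by
  induction len with
  | zero => rfl
  | succ l ih => rw [chainProd_succ, chainProd_succ, ih, add_assoc]

end ChainProd

section PolyChain

variable {K : Type*} [CommSemiring K] {σ : Type*} {V : Type*} [Fintype V] [DecidableEq V]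

/-- A chain of `len` matrices with entries of degree `≤ Δ` has entries of degree `≤ len·Δ` (a path
with `len` edges "computes a polynomial of degree at most" the sum of the label degrees, cf. p0008:L60).
[cite: ChatterjeeKumarSheVolk2022, §2] -/
theorem totalDegree_chainProd_le {M : ℕ → Matrix V V (MvPolynomial σ K)} {Δ : ℕ}
    (hdeg : ∀ j u v, (M j u v).totalDegree ≤ Δ) (a len : ℕ) (u v : V) :
    (chainProd M a len u v).totalDegree ≤ len * Δ := by
  induction len generalizing v with
  | zero =>
    rw [chainProd_zero, Matrix.one_apply]
    split_ifs
    · rw [totalDegree_one]; exact Nat.zero_le _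
    · rw [totalDegree_zero]; exact Nat.zero_le _
  | succ l ih =>
    rw [chainProd_succ, Matrix.mul_apply]
    refine (totalDegree_finsetSum _ _).trans (Finset.sup_le fun w _ => ?_)
    refine (totalDegree_mul _ _).trans ?_
    have h1 := ih w
    have h2 := hdeg (a + l) w v
    rw [Nat.succ_mul]
    omega

/-- Support propagation along a chain (Def. 1, "layered": every path from layer `a` with `len ≥ 1`
edges ends in layer `a + len`): if every `M j` is supported on `S j × S (j+1)`, a chain of `len ≥ 1`
factors starting at `a` is supported on `S a × S (a + len)`. [cite: ChatterjeeKumarSheVolk2022, Definition 1] -/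
theorem chainProd_apply_ne_zero {M : ℕ → Matrix V V (MvPolynomial σ K)} {S : ℕ → Finset V}
    (hsupp : ∀ j u v, M j u v ≠ 0 → u ∈ S j ∧ v ∈ S (j + 1)) {a len : ℕ} (hlen : 1 ≤ len) {u v : V}
    (h : chainProd M a len u v ≠ 0) : u ∈ S a ∧ v ∈ S (a + len) := by
  induction len generalizing v with
  | zero => omega
  | succ l ih =>
    rw [chainProd_succ, Matrix.mul_apply] at h
    obtain ⟨w, -, hw⟩ := Finset.exists_ne_zero_of_sum_ne_zero h
    have h1 : chainProd M a l u w ≠ 0 := fun h0 => hw (by rw [h0, zero_mul])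
    have h2 : M (a + l) w v ≠ 0 := fun h0 => hw (by rw [h0, mul_zero])
    obtain ⟨hw1, hv⟩ := hsupp _ _ _ h2
    rcases Nat.eq_zero_or_pos l with rfl | hl
    · rw [chainProd_zero, Matrix.one_apply] at h1
      have huw : u = w := by by_contra h'; exact h1 (if_neg h')
      subst huw
      rw [add_zero] at hw1
      exact ⟨hw1, hv⟩
    · exact ⟨(ih hl h1).1, by rw [← add_assoc]; exact hv⟩

end PolyChain

/-! ### Definition 1 / Definition 5 in the matrix rendering: layered components -/

/-- **One layered ABP with edge labels of degree `≤ Δ`, as a chain of matrices** (Def. 1 in the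
rendering of §1.1, p0004:L1–L6, module docstring): an ambient index type `Fin k`, start and end
indices `s, t`, `D ≥ 1` matrices `M 0, …, M (D−1)` (`D + 1` layers), layer supports `S i` with
`S 0 = {s}`, `S D = {t}` ("the first and the last layer have one vertex each", p0003), every `M i`
supported on `S i × S (i+1)` ("layered": edges go from a layer to the next) with entries of degree
`≤ Δ`. The components of a multilayered ABP (Def. 5, p0009:L8–L15) are such chains sharing `s`, `t`.
[cite: ChatterjeeKumarSheVolk2022, Definition 1, Definition 5] -/
structure Comp (σ : Type*) (K : Type*) [CommSemiring K] (Δ : ℕ) where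
  /-- size of the ambient index type -/
  k : ℕ
  /-- the start vertex -/
  s : Fin k
  /-- the end vertex -/
  t : Fin k
  /-- number of matrices (`=` number of layers `− 1`) -/
  D : ℕ
  one_le_D : 1 ≤ D
  /-- layer supports -/
  S : ℕ → Finset (Fin k)
  /-- the matrices of edge labels between consecutive layers -/
  M : ℕ → Matrix (Fin k) (Fin k) (MvPolynomial σ K)
  S_zero : S 0 = {s}
  S_D : S D = {t}
  supp : ∀ j u v, M j u v ≠ 0 → u ∈ S j ∧ v ∈ S (j + 1)
  deg : ∀ j u v, (M j u v).totalDegree ≤ Δ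

namespace Comp

section Basic

variable {σ : Type*} {K : Type*} [CommSemiring K] {Δ : ℕ}

/-- The polynomial computed: the `(s,t)` entry of `M 0 ⋯ M (D−1)` ("the (only) entry of the `1 × 1`
matrix given by the product", p0004:L3). [cite: ChatterjeeKumarSheVolk2022, §1.1] -/
def eval (c : Comp σ K Δ) : MvPolynomial σ K := chainProd c.M 0 c.D c.s c.t

/-- The number of internal vertices `Σ_{0<i<D} |S i|` (size minus the start and end vertex; Def. 5's
`τ_i − 2`, p0009:L13). [cite: ChatterjeeKumarSheVolk2022, Definition 5] -/
def internal (c : Comp σ K Δ) : ℕ := ∑ i ∈ Finset.Ico 1 c.D, (c.S i).card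

/-- A component with `D` matrices of degree `≤ Δ` computes a polynomial of degree `≤ D·Δ`.
[cite: ChatterjeeKumarSheVolk2022, §2] -/
theorem totalDegree_eval_le (c : Comp σ K Δ) : c.eval.totalDegree ≤ c.D * Δ :=
  totalDegree_chainProd_le c.deg _ _ _ _

end Basic


/-! ### Lemma 10 with Claim 11: cutting a component at an internal layer -/

section Cut

variable {σ : Type*} {K : Type*} [CommRing K] {Δ : ℕ}

/-- `U = M 0 ⋯ M (j−1)`: row `s` is the vector of polynomials `[s,u]`, `u` in layer `j` (p0010:L29).
[cite: ChatterjeeKumarSheVolk2022, Lemma 10] -/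
def pre (c : Comp σ K Δ) (j : ℕ) : Matrix (Fin c.k) (Fin c.k) (MvPolynomial σ K) := chainProd c.M 0 j

/-- `V = M j ⋯ M (D−1)`: column `t` is the vector of polynomials `[u,t]`, `u` in layer `j` (p0010:L29).
[cite: ChatterjeeKumarSheVolk2022, Lemma 10] -/
def suf (c : Comp σ K Δ) (j : ℕ) : Matrix (Fin c.k) (Fin c.k) (MvPolynomial σ K) :=
  chainProd c.M j (c.D - j)

/-- `α_u` = the constant term of `[s,u]` (p0010:L29–L31). [cite: ChatterjeeKumarSheVolk2022, Lemma 10] -/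
def α (c : Comp σ K Δ) (j : ℕ) (u : Fin c.k) : K := constantCoeff (c.pre j c.s u)

/-- `β_u` = the constant term of `[u,t]` (p0010:L29–L31). [cite: ChatterjeeKumarSheVolk2022, Lemma 10] -/
def β (c : Comp σ K Δ) (j : ℕ) (u : Fin c.k) : K := constantCoeff (c.suf j u c.t)

/-- `P_u = [s,u] − α_u` (p0010:L31). [cite: ChatterjeeKumarSheVolk2022, Lemma 10] -/
def errP (c : Comp σ K Δ) (j : ℕ) (u : Fin c.k) : MvPolynomial σ K := c.pre j c.s u - C (c.α j u)

/-- `Q_u = [u,t] − β_u` (p0010:L31). [cite: ChatterjeeKumarSheVolk2022, Lemma 10] -/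
def errQ (c : Comp σ K Δ) (j : ℕ) (u : Fin c.k) : MvPolynomial σ K := c.suf j u c.t - C (c.β j u)

/-- The scalar `Σ_u α_u β_u` of Lemma 10 (p0010:L33). [cite: ChatterjeeKumarSheVolk2022, Lemma 10] -/
def δ (c : Comp σ K Δ) (j : ℕ) : K := ∑ u ∈ c.S j, c.α j u * c.β j u

/-- `P_u` has no constant term. [cite: ChatterjeeKumarSheVolk2022, Lemma 10] -/
@[simp] theorem constantCoeff_errP (c : Comp σ K Δ) (j : ℕ) (u : Fin c.k) :
    constantCoeff (c.errP j u) = 0 := by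
  rw [errP, map_sub, constantCoeff_C, α, sub_self]

/-- `Q_u` has no constant term. [cite: ChatterjeeKumarSheVolk2022, Lemma 10] -/
@[simp] theorem constantCoeff_errQ (c : Comp σ K Δ) (j : ℕ) (u : Fin c.k) :
    constantCoeff (c.errQ j u) = 0 := by
  rw [errQ, map_sub, constantCoeff_C, β, sub_self]

/-- The one-row matrix `s ↦ (α_u)_u`: the new edges `s → u` of the program `𝒞` ("whose set of
vertices is `s` along the vertices in the layers `ℓ, …, d`", p0010:L47), already merged with the next
layer as in Claim 11. [cite: ChatterjeeKumarSheVolk2022, Lemma 10, Claim 11] -/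
def rowMat (c : Comp σ K Δ) (j : ℕ) : Matrix (Fin c.k) (Fin c.k) (MvPolynomial σ K) :=
  Matrix.of fun u v => if u = c.s then C (c.α j v) else 0

/-- The one-column matrix `u ↦ β_u`: the new edges `u → t` of the program `ℬ` ("connecting the vertex
`u_i` in the `ℓ`-th layer to `t` by an edge of weight `β_i`", p0010:L45).
[cite: ChatterjeeKumarSheVolk2022, Lemma 10, Claim 11] -/
def colMat (c : Comp σ K Δ) (j : ℕ) : Matrix (Fin c.k) (Fin c.k) (MvPolynomial σ K) :=
  Matrix.of fun u v => if v = c.t then C (c.β j u) else 0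

/-- Multiplying a label by a scalar edge keeps the degree `≤ Δ` (Claim 11: "the expression
`(Σ_i [v_i,b][u_j,v_i])` is a polynomial of degree at most `Δ`", p0011:L33). [cite: ChatterjeeKumarSheVolk2022, Claim 11] -/
private theorem totalDegree_ite_C_mul_le {p : Prop} [Decidable p] (a : K) (f : MvPolynomial σ K) {Δ : ℕ}
    (hf : f.totalDegree ≤ Δ) : ((if p then C a else 0) * f).totalDegree ≤ Δ := by
  refine (totalDegree_mul _ _).trans ?_
  have : (if p then C a else (0 : MvPolynomial σ K)).totalDegree = 0 := by
    split_ifs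
    · exact totalDegree_C a
    · exact totalDegree_zero
  rw [this, zero_add]; exact hf

/-- Symmetric form of the previous lemma. [cite: ChatterjeeKumarSheVolk2022, Claim 11] -/
private theorem totalDegree_mul_ite_C_le {p : Prop} [Decidable p] (a : K) (f : MvPolynomial σ K) {Δ : ℕ}
    (hf : f.totalDegree ≤ Δ) : (f * (if p then C a else 0)).totalDegree ≤ Δ := by
  rw [mul_comm]; exact totalDegree_ite_C_mul_le a f hf

/-- **The program `ℬ'` of Lemma 10 / Claim 11** (p0010:L43–L46, p0011:L1–L5): the first `j` layers
of the component, the vertices of layer `j − 1` joined directly to `t` by the labels `M (j−1)·β`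
("we delete the vertices `v_1, …, v_r` … and for every `j`, we connect the vertex `u_j` with the end
vertex using an edge with label `Σ_i [v_i,b][u_j,v_i]`", p0011:L35–L38). It has `j + 1` layers.
[cite: ChatterjeeKumarSheVolk2022, Lemma 10, Claim 11] -/
def cutLeft (c : Comp σ K Δ) (j : ℕ) (hj : 1 ≤ j) (_hjD : j < c.D) : Comp σ K Δ where
  k := c.k
  s := c.s
  t := c.t
  D := j
  one_le_D := hj
  S := fun i => if i < j then c.S i else if i = j then {c.t} else ∅
  M := fun i => if i + 1 < j then c.M i else if i + 1 = j then c.M i * c.colMat j else 0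
  S_zero := by rw [if_pos (by omega), c.S_zero]
  S_D := by rw [if_neg (lt_irrefl j), if_pos rfl]
  supp := by
    intro i u v h
    by_cases h1 : i + 1 < j
    · rw [if_pos h1] at h
      obtain ⟨hu, hv⟩ := c.supp i u v h
      exact ⟨by rwa [if_pos (by omega)], by rwa [if_pos h1]⟩
    · rw [if_neg h1] at h
      by_cases h2 : i + 1 = j
      · rw [if_pos h2, Matrix.mul_apply] at h
        obtain ⟨w, -, hw⟩ := Finset.exists_ne_zero_of_sum_ne_zero h
        have hM : c.M i u w ≠ 0 := fun h0 => hw (by rw [h0, zero_mul])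
        have hvt : v = c.t := by
          by_contra hne
          exact hw (by rw [colMat, Matrix.of_apply, if_neg hne, mul_zero])
        refine ⟨by rw [if_pos (by omega)]; exact (c.supp i u w hM).1, ?_⟩
        rw [if_neg (by omega), if_pos h2, hvt]
        exact Finset.mem_singleton_self _
      · rw [if_neg h2] at h
        exact absurd rfl h
  deg := by
    intro i u v
    by_cases h1 : i + 1 < j
    · rw [if_pos h1]; exact c.deg i u v
    · rw [if_neg h1]
      by_cases h2 : i + 1 = j
      · rw [if_pos h2, Matrix.mul_apply]
        refine (totalDegree_finsetSum _ _).trans (Finset.sup_le fun w _ => ?_)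
        rw [colMat, Matrix.of_apply]
        exact totalDegree_mul_ite_C_le _ _ (c.deg i u w)
      · rw [if_neg h2]
        rw [Matrix.zero_apply, totalDegree_zero]
        exact Nat.zero_le _

/-- **The program `𝒞'` of Lemma 10 / Claim 11** (p0010:L47–L48 and the "analogous statement" of
Claim 11, p0010:L60): `s` joined to the vertices of layer `j + 1` by the labels `α·M j`, then the
layers `j + 1, …, D` of the component. It has `D − j + 1` layers.
[cite: ChatterjeeKumarSheVolk2022, Lemma 10, Claim 11] -/
def cutRight (c : Comp σ K Δ) (j : ℕ) (_hj : 1 ≤ j) (hjD : j < c.D) : Comp σ K Δ where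
  k := c.k
  s := c.s
  t := c.t
  D := c.D - j
  one_le_D := by omega
  S := fun i => if i = 0 then {c.s} else c.S (j + i)
  M := fun i => if i = 0 then c.rowMat j * c.M j else c.M (j + i)
  S_zero := by rw [if_pos rfl]
  S_D := by rw [if_neg (by omega), Nat.add_sub_cancel' hjD.le, c.S_D]
  supp := by
    intro i u v h
    by_cases h1 : i = 0
    · subst h1
      rw [if_pos rfl, Matrix.mul_apply] at h
      obtain ⟨w, -, hw⟩ := Finset.exists_ne_zero_of_sum_ne_zero h
      have hM : c.M j w v ≠ 0 := fun h0 => hw (by rw [h0, mul_zero])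
      have hus : u = c.s := by
        by_contra hne
        exact hw (by rw [rowMat, Matrix.of_apply, if_neg hne, zero_mul])
      refine ⟨by rw [if_pos rfl, hus]; exact Finset.mem_singleton_self _, ?_⟩
      rw [if_neg (by omega)]
      exact (c.supp j w v hM).2
    · rw [if_neg h1] at h
      obtain ⟨hu, hv⟩ := c.supp _ u v h
      refine ⟨by rwa [if_neg h1], ?_⟩
      rw [if_neg (by omega), ← add_assoc]
      exact hv
  deg := by
    intro i u v
    by_cases h1 : i = 0
    · subst h1
      rw [if_pos rfl, Matrix.mul_apply]
      refine (totalDegree_finsetSum _ _).trans (Finset.sup_le fun w _ => ?_)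
      rw [rowMat, Matrix.of_apply]
      exact totalDegree_ite_C_mul_le _ _ (c.deg j w v)
    · rw [if_neg h1]; exact c.deg _ u v

/-- Depth of `ℬ'`: `j` matrices. [cite: ChatterjeeKumarSheVolk2022, Lemma 10] -/
@[simp] theorem cutLeft_D (c : Comp σ K Δ) (j : ℕ) (hj : 1 ≤ j) (hjD : j < c.D) :
    (c.cutLeft j hj hjD).D = j := rfl

/-- Depth of `𝒞'`: `D − j` matrices. [cite: ChatterjeeKumarSheVolk2022, Lemma 10] -/
@[simp] theorem cutRight_D (c : Comp σ K Δ) (j : ℕ) (hj : 1 ≤ j) (hjD : j < c.D) :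
    (c.cutRight j hj hjD).D = c.D - j := rfl

/-- `ℬ'` computes `U·β = Σ_u [s,u]·β_u` (p0010:L43). [cite: ChatterjeeKumarSheVolk2022, Lemma 10] -/
theorem eval_cutLeft (c : Comp σ K Δ) (j : ℕ) (hj : 1 ≤ j) (hjD : j < c.D) :
    (c.cutLeft j hj hjD).eval = ∑ u, c.pre j c.s u * C (c.β j u) := by
  obtain ⟨j', rfl⟩ : ∃ j', j = j' + 1 := ⟨j - 1, by omega⟩
  have key : chainProd (c.cutLeft (j' + 1) hj hjD).M 0 (j' + 1) = c.pre (j' + 1) * c.colMat (j' + 1) := by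
    rw [chainProd_succ, zero_add, pre, chainProd_succ, zero_add, Matrix.mul_assoc]
    have h1 : chainProd (c.cutLeft (j' + 1) hj hjD).M 0 j' = chainProd c.M 0 j' :=
      chainProd_congr fun i _ hi => by
        show (if i + 1 < j' + 1 then c.M i else _) = c.M i
        rw [if_pos (by omega)]
    have h2 : (c.cutLeft (j' + 1) hj hjD).M j' = c.M j' * c.colMat (j' + 1) := by
      show (if j' + 1 < j' + 1 then c.M j' else if j' + 1 = j' + 1 then _ else _) = _
      rw [if_neg (lt_irrefl _), if_pos rfl]
    rw [h1, h2]
    rfl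
  show chainProd (c.cutLeft (j' + 1) hj hjD).M 0 (j' + 1) c.s c.t = _
  rw [key, Matrix.mul_apply]
  refine Finset.sum_congr rfl fun u _ => ?_
  rw [colMat, Matrix.of_apply, if_pos rfl]

/-- `𝒞'` computes `α·V = Σ_u α_u·[u,t]` (p0010:L47). [cite: ChatterjeeKumarSheVolk2022, Lemma 10] -/
theorem eval_cutRight (c : Comp σ K Δ) (j : ℕ) (hj : 1 ≤ j) (hjD : j < c.D) :
    (c.cutRight j hj hjD).eval = ∑ u, C (c.α j u) * c.suf j u c.t := by
  obtain ⟨e, he⟩ : ∃ e, c.D - j = e + 1 := ⟨c.D - j - 1, by omega⟩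
  have key : chainProd (c.cutRight j hj hjD).M 0 (c.D - j) = c.rowMat j * c.suf j := by
    rw [he, chainProd_succ_left, zero_add, suf, he, chainProd_succ_left, ← Matrix.mul_assoc]
    have h1 : chainProd (c.cutRight j hj hjD).M 1 e = chainProd c.M (j + 1) e := by
      rw [← chainProd_shift c.M j 1 e]
      exact chainProd_congr fun i hi _ => by
        show (if i = 0 then c.rowMat j * c.M j else c.M (j + i)) = c.M (j + i)
        rw [if_neg (by omega)]
    have h2 : (c.cutRight j hj hjD).M 0 = c.rowMat j * c.M j := by
      show (if (0:ℕ) = 0 then c.rowMat j * c.M j else c.M (j + 0)) = _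
      rw [if_pos rfl]
    rw [h1, h2]
    rfl
  show chainProd (c.cutRight j hj hjD).M 0 (c.D - j) c.s c.t = _
  rw [key, Matrix.mul_apply]
  refine Finset.sum_congr rfl fun u _ => ?_
  rw [rowMat, Matrix.of_apply, if_pos rfl]

/-- The cut identity `[s,t] = Σ_u [s,u]·[u,t]` over layer `j` (p0010:L37: "`F = [s,t] = Σ_i [s,u_i]·[u_i,t]`").
[cite: ChatterjeeKumarSheVolk2022, Lemma 10] -/
theorem eval_eq_sum_pre_mul_suf (c : Comp σ K Δ) (j : ℕ) (hjD : j ≤ c.D) :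
    c.eval = ∑ u, c.pre j c.s u * c.suf j u c.t := by
  have hD : c.D = j + (c.D - j) := (Nat.add_sub_cancel' hjD).symm
  rw [eval, hD, chainProd_add, zero_add, Matrix.mul_apply]
  rfl

/-- Outside layer `j` the entries `[s,u]` vanish (`j ≥ 1`). [cite: ChatterjeeKumarSheVolk2022, Lemma 10] -/
theorem pre_apply_eq_zero (c : Comp σ K Δ) {j : ℕ} (hj : 1 ≤ j) {u : Fin c.k} (hu : u ∉ c.S j) :
    c.pre j c.s u = 0 := by
  by_contra h
  exact hu (by simpa using (chainProd_apply_ne_zero c.supp hj h).2)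

/-- **Lemma 10** (p0010:L27–L35): "there is a multilayered ABP `𝒜'`, with at most `max{ℓ, d−ℓ+1}`
layers and size at most `|𝒜| − |L|`" — here: the two programs `ℬ'`, `𝒞'` — "that computes the
polynomial `F − Σ_i P_i·Q_i + Σ_i α_i·β_i`." PROVED as the identity
`F = [ℬ'] + [𝒞'] + Σ_{u ∈ S j} P_u Q_u − Σ_{u ∈ S j} α_u β_u`.
[cite: ChatterjeeKumarSheVolk2022, Lemma 10] -/
theorem eval_cut (c : Comp σ K Δ) (j : ℕ) (hj : 1 ≤ j) (hjD : j < c.D) :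
    c.eval = (c.cutLeft j hj hjD).eval + (c.cutRight j hj hjD).eval
      + ∑ u ∈ c.S j, c.errP j u * c.errQ j u - C (c.δ j) := by
  rw [eval_cutLeft, eval_cutRight, c.eval_eq_sum_pre_mul_suf j hjD.le, δ, map_sum]
  -- extend the two sums over `S j` to all of `Fin k`: the other terms vanish
  have hP0 : ∀ u, u ∉ c.S j → c.errP j u = 0 := fun u hu => by
    rw [errP, α, c.pre_apply_eq_zero hj hu, map_zero, C_0, sub_zero]
  have hα0 : ∀ u, u ∉ c.S j → c.α j u = 0 := fun u hu => by
    rw [α, c.pre_apply_eq_zero hj hu, map_zero]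
  have e1 : ∑ u ∈ c.S j, c.errP j u * c.errQ j u = ∑ u, c.errP j u * c.errQ j u :=
    Finset.sum_subset (Finset.subset_univ _) fun u _ hu => by rw [hP0 u hu, zero_mul]
  have e2 : ∑ u ∈ c.S j, (C (c.α j u * c.β j u) : MvPolynomial σ K) = ∑ u, C (c.α j u * c.β j u) :=
    Finset.sum_subset (Finset.subset_univ _) fun u _ hu => by rw [hα0 u hu, zero_mul, C_0]
  rw [e1, e2, ← Finset.sum_add_distrib, ← Finset.sum_add_distrib, ← Finset.sum_sub_distrib]
  refine Finset.sum_congr rfl fun u _ => ?_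
  rw [errP, errQ, map_mul]
  ring

/-- **Lemma 10, size count** (p0010:L50–p0011:L5, eq. (overlap) and Claim 11): the two new programs
have `|S j|` fewer internal vertices than the component: `internal ℬ' + internal 𝒞' + |S j| = internal`.
[cite: ChatterjeeKumarSheVolk2022, Lemma 10, Claim 11] -/
theorem internal_cut (c : Comp σ K Δ) (j : ℕ) (hj : 1 ≤ j) (hjD : j < c.D) :
    (c.cutLeft j hj hjD).internal + (c.cutRight j hj hjD).internal + (c.S j).card = c.internal := by
  have hL : (c.cutLeft j hj hjD).internal = ∑ i ∈ Finset.Ico 1 j, (c.S i).card := by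
    show ∑ i ∈ Finset.Ico 1 j, (if i < j then c.S i else _).card = _
    exact Finset.sum_congr rfl fun i hi => by rw [if_pos (Finset.mem_Ico.1 hi).2]
  have hR : (c.cutRight j hj hjD).internal = ∑ i ∈ Finset.Ico (j + 1) c.D, (c.S i).card := by
    show ∑ i ∈ Finset.Ico 1 (c.D - j), (if i = 0 then {c.s} else c.S (j + i)).card = _
    have : Finset.Ico (j + 1) c.D = (Finset.Ico 1 (c.D - j)).map (addLeftEmbedding j) := by
      rw [Finset.map_add_left_Ico, Nat.add_sub_cancel' hjD.le]
    rw [this, Finset.sum_map]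
    exact Finset.sum_congr rfl fun i hi => by
      rw [if_neg (by have := (Finset.mem_Ico.1 hi).1; omega)]; rfl
  rw [hL, hR, internal, add_assoc, add_comm (∑ i ∈ Finset.Ico (j + 1) c.D, (c.S i).card),
    ← Finset.sum_eq_sum_Ico_succ_bot hjD (fun i => (c.S i).card),
    Finset.sum_Ico_consecutive _ hj hjD.le]

end Cut

end Comp

/-! ### Lemma 12 / Claim 13: one round of depth reduction of a multilayered ABP -/

section Step

variable {σ : Type*} {K : Type*} [CommRing K] {Δ : ℕ}

/-- The load of layer `j`: `ℓ_j = Σ_i ℓ_{i,j}` summed over the components deep enough to be cut at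
`j` (p0011:L44–L46, p0012:L44). [cite: ChatterjeeKumarSheVolk2022, Lemma 12, Claim 13] -/
def load {ι : Type*} [Fintype ι] (A : ι → Comp σ K Δ) (j : ℕ) : ℕ :=
  ∑ i, if j < (A i).D then ((A i).S j).card else 0

/-- Summing the loads of distinct internal layers counts internal vertices at most once:
`Σ_{j ∈ J} ℓ_j ≤ |𝒜| − 2` ("`ℓ ≤ τ`", p0012:L46). [cite: ChatterjeeKumarSheVolk2022, Claim 13] -/
theorem sum_load_le {ι : Type*} [Fintype ι] (A : ι → Comp σ K Δ) (J : Finset ℕ)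
    (hJ : ∀ j ∈ J, 1 ≤ j) : ∑ j ∈ J, load A j ≤ ∑ i, (A i).internal := by
  unfold load
  rw [Finset.sum_comm]
  refine Finset.sum_le_sum fun i _ => ?_
  rw [← Finset.sum_filter]
  refine Finset.sum_le_sum_of_subset_of_nonneg (fun j hj => ?_) (fun _ _ _ => Nat.zero_le _)
  rw [Finset.mem_filter] at hj
  exact Finset.mem_Ico.2 ⟨hJ j hj.1, hj.2⟩

/-- The middle window of layers `(L/3, 2L/3]` (p0011:L45: "`ℓ = min_{j ∈ (d/3, 2d/3)} Σ_i ℓ_{i,j}`";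
here counted in matrices, `L = d − 1`). [cite: ChatterjeeKumarSheVolk2022, Lemma 12] -/
def window (L : ℕ) : Finset ℕ := Finset.Ioc (L / 3) (2 * L / 3)

/-- The window is non-empty once `L ≥ 2`. [cite: ChatterjeeKumarSheVolk2022, Lemma 12] -/
theorem window_nonempty {L : ℕ} (hL : 2 ≤ L) : (window L).Nonempty := by
  rw [window, Finset.nonempty_Ioc]
  obtain ⟨q, hq⟩ : ∃ q, L = 3 * q ∨ L = 3 * q + 1 ∨ L = 3 * q + 2 := ⟨L / 3, by omega⟩
  rcases hq with rfl | rfl | rfl <;> omega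

/-- The window has at least `(L − 1)/3` layers (the averaging denominator "`d_k/3`", p0012:L47).
[cite: ChatterjeeKumarSheVolk2022, Claim 13] -/
theorem three_mul_card_window (L : ℕ) : L - 1 ≤ 3 * (window L).card := by
  rw [window, Nat.card_Ioc]
  obtain ⟨q, hq⟩ : ∃ q, L = 3 * q ∨ L = 3 * q + 1 ∨ L = 3 * q + 2 := ⟨L / 3, by omega⟩
  rcases hq with rfl | rfl | rfl <;> omega

/-- A window layer is internal and cutting there leaves depth `≤ 2L/3` on both sides ("at most
`max{ℓ, d − ℓ + 1} ≤ 2d/3` layers", p0011:L9). [cite: ChatterjeeKumarSheVolk2022, Lemma 10, Lemma 12] -/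
theorem mem_window {L j : ℕ} (h : j ∈ window L) :
    1 ≤ j ∧ 3 * j ≤ 2 * L ∧ 3 * (L - j) ≤ 2 * L ∧ j ≤ L := by
  rw [window, Finset.mem_Ioc] at h
  obtain ⟨q, hq⟩ : ∃ q, L = 3 * q ∨ L = 3 * q + 1 ∨ L = 3 * q + 2 := ⟨L / 3, by omega⟩
  rcases hq with rfl | rfl | rfl <;> omega

/-- Cut a component at `j` if it is deep enough, left piece (else keep it). [cite: ChatterjeeKumarSheVolk2022, Lemma 12] -/
def cutL (c : Comp σ K Δ) (j : ℕ) (hj : 1 ≤ j) : Comp σ K Δ :=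
  if h : j < c.D then c.cutLeft j hj h else c

/-- Cut a component at `j` if it is deep enough, right piece. [cite: ChatterjeeKumarSheVolk2022, Lemma 12] -/
def cutR (c : Comp σ K Δ) (j : ℕ) (hj : 1 ≤ j) : Comp σ K Δ :=
  if h : j < c.D then c.cutRight j hj h else c

/-- **Lemma 12's new multilayered ABP** (p0011:L48–L60): the components with fewer than `j + 1`
matrices are kept (`𝒜''`), every deeper one is replaced by its two pieces `ℬ'_i`, `𝒞'_i` of Lemma 10.
Indexed by `ι ⊕ {i // j < D_i}`. [cite: ChatterjeeKumarSheVolk2022, Lemma 12] -/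
def step {ι : Type*} (A : ι → Comp σ K Δ) (j : ℕ) (hj : 1 ≤ j) :
    ι ⊕ {i : ι // j < (A i).D} → Comp σ K Δ :=
  Sum.elim (fun i => cutL (A i) j hj) (fun p => cutR (A p.1) j hj)

/-- Depth after the step: "at most `max{j, d − j + 1}` layers" (p0011:L9, p0011:L57).
[cite: ChatterjeeKumarSheVolk2022, Lemma 12] -/
theorem step_D_le {ι : Type*} (A : ι → Comp σ K Δ) (j : ℕ) (hj : 1 ≤ j) {L : ℕ}
    (hL : ∀ i, (A i).D ≤ L) (x : ι ⊕ {i : ι // j < (A i).D}) : (step A j hj x).D ≤ max j (L - j) := by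
  rcases x with i | ⟨i, hi⟩
  · simp only [step, Sum.elim_inl, cutL]
    split_ifs with h
    · exact le_max_left _ _
    · exact (not_lt.1 h).trans (le_max_left _ _)
  · simp only [step, Sum.elim_inr, cutR, dif_pos hi, Comp.cutRight_D]
    exact (Nat.sub_le_sub_right (hL i) j).trans (le_max_right _ _)

/-- A sum over the cut components as a sum over all components. [folklore] -/
private theorem sum_subtype_eq_sum_ite {ι : Type*} [Fintype ι] {N : Type*} [AddCommMonoid N]
    (P : ι → Prop) [DecidablePred P] (g : ι → N) :
    ∑ p : {i // P i}, g p.1 = ∑ i, if P i then g i else 0 := by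
  rw [← Finset.sum_filter]
  exact (Finset.sum_subtype _ (fun x => by simp) g).symm

/-- **Lemma 12, size** (p0011:L58–L60: "size at most `|𝒜'|` … size at most `|𝒜|`", with Lemma 10's
exact count): the step removes exactly the `ℓ_j` cut vertices. [cite: ChatterjeeKumarSheVolk2022, Lemma 12] -/
theorem internal_step {ι : Type*} [Fintype ι] (A : ι → Comp σ K Δ) (j : ℕ) (hj : 1 ≤ j) :
    ∑ x, (step A j hj x).internal + load A j = ∑ i, (A i).internal := by
  classical
  rw [Fintype.sum_sum_type]
  simp only [step, Sum.elim_inl, Sum.elim_inr]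
  rw [sum_subtype_eq_sum_ite (fun i => j < (A i).D) (fun i => (cutR (A i) j hj).internal), load,
    ← Finset.sum_add_distrib, ← Finset.sum_add_distrib]
  refine Finset.sum_congr rfl fun i _ => ?_
  by_cases h : j < (A i).D
  · rw [if_pos h, if_pos h, cutL, cutR, dif_pos h, dif_pos h]
    exact (A i).internal_cut j hj h
  · rw [if_neg h, if_neg h, cutL, dif_neg h, add_zero, add_zero]

/-- **Lemma 12** (p0011:L42–L47): the new multilayered ABP "computes a polynomial of the form
`F − Σ_{i=1}^{ℓ} P_i·Q_i + δ`, where `P_1, …, Q_ℓ` … [have] constant term zero and `δ ∈ 𝔽`",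
PROVED as `Σ_i F_i = Σ [step] + Σ_{cut i} Σ_{u ∈ S_i j} P_u Q_u − C(Σ_{cut i} δ_i)`.
[cite: ChatterjeeKumarSheVolk2022, Lemma 12] -/
theorem eval_step {ι : Type*} [Fintype ι] (A : ι → Comp σ K Δ) (j : ℕ) (hj : 1 ≤ j) :
    ∑ i, (A i).eval = ∑ x, (step A j hj x).eval
      + ∑ p : {i : ι // j < (A i).D}, ∑ u ∈ (A p.1).S j, (A p.1).errP j u * (A p.1).errQ j u
      - C (∑ p : {i : ι // j < (A i).D}, (A p.1).δ j) := by
  classical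
  rw [Fintype.sum_sum_type, map_sum]
  simp only [step, Sum.elim_inl, Sum.elim_inr]
  rw [sum_subtype_eq_sum_ite (fun i => j < (A i).D) (fun i => (cutR (A i) j hj).eval),
    sum_subtype_eq_sum_ite (fun i => j < (A i).D)
      (fun i => ∑ u ∈ (A i).S j, (A i).errP j u * (A i).errQ j u),
    sum_subtype_eq_sum_ite (fun i => j < (A i).D) (fun i => (C ((A i).δ j) : MvPolynomial σ K)),
    ← Finset.sum_add_distrib, ← Finset.sum_add_distrib, ← Finset.sum_sub_distrib]
  refine Finset.sum_congr rfl fun i _ => ?_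
  by_cases h : j < (A i).D
  · rw [if_pos h, if_pos h, if_pos h, cutL, cutR, dif_pos h, dif_pos h]
    exact (A i).eval_cut j hj h
  · rw [if_neg h, if_neg h, if_neg h, cutL, dif_neg h, add_zero, add_zero, sub_zero]

end Step

/-! ### The iteration (proof of Theorem 1.1, p0012) -/

section Reduction

/-- The last round of the geometric sum: `ℓ·(L−1) ≤ 3T` and `q ≤ L − 1` give the invariant with
`r = ℓ`. [cite: ChatterjeeKumarSheVolk2022, Theorem 1.1 (proof)] -/
theorem bound_last {ℓ q T e : ℕ} (hq : q ≤ e) (h2 : ℓ * e ≤ 3 * T) :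
    ℓ * q * e + 6 * T * q ≤ 9 * T * e := by
  have h1 : ℓ * q * e = q * (ℓ * e) := by ring
  rw [h1]
  calc q * (ℓ * e) + 6 * T * q ≤ q * (3 * T) + 6 * T * q :=
        Nat.add_le_add_right (Nat.mul_le_mul_left _ h2) _
    _ = 9 * T * q := by ring
    _ ≤ 9 * T * e := Nat.mul_le_mul_left _ hq

/-- One round of the geometric sum (footnote p0006: "the number of error terms can be upper bounded by
a geometric progression … common ratio being a constant less than `1`"; p0012:L27–L31:
"`1/d_{k−1} ≤ (2/3)·1/d_k`"): the invariant `r ≤ 3T(3/q − 2/e)` survives adding `ℓ ≤ 3T/e` errors when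
the depth drops to `e₁ ≤ 2e/3`. [cite: ChatterjeeKumarSheVolk2022, Theorem 1.1 (proof)] -/
theorem bound_step {r₁ ℓ q T e e₁ : ℕ} (he₁ : 1 ≤ e₁) (h3 : 3 * e₁ ≤ 2 * e)
    (h1 : r₁ * q * e₁ + 6 * T * q ≤ 9 * T * e₁) (h2 : ℓ * e ≤ 3 * T) :
    (ℓ + r₁) * q * e + 6 * T * q ≤ 9 * T * e := by
  refine Nat.le_of_mul_le_mul_right ?_ he₁
  have k1 : (r₁ * q * e₁ + 6 * T * q) * e ≤ 9 * T * e₁ * e := Nat.mul_le_mul_right e h1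
  have k2 : ℓ * e * (q * e₁) ≤ 3 * T * (q * e₁) := Nat.mul_le_mul_right _ h2
  have k3 : 3 * T * q * (3 * e₁) ≤ 3 * T * q * (2 * e) := Nat.mul_le_mul_left _ h3
  nlinarith [k1, k2, k3]

variable {σ : Type*} {K : Type*} [CommRing K] {Δ : ℕ}

/-- **Depth reduction** (Claim 13 iterated, p0012:L1–L37): a multilayered ABP all of whose
components have at most `L` matrices and with at most `T` internal vertices computes
`F' + Σ_{x<r} P_x Q_x + c₀` where `F'` is computed by a multilayered ABP whose depth `L'` has
`L'Δ < n`, all `P_x, Q_x` are constant free, `c₀ ∈ K`, and the number `r` of error terms satisfies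
`r·q·(L−1) + 6Tq ≤ 9T(L−1)`, `q = ⌊n/Δ⌋ − 1` (i.e. `r ≤ 3T(3/q − 2/(L−1)) ≤ 9T/q`; "the number of
error terms, `r`, is at most `0.005 n²/Δ · (1/d_{K−1} + ⋯ + 1/d_0)`", p0012:L25), and `r = 0` if
already `LΔ < n`. [cite: ChatterjeeKumarSheVolk2022, Claim 13, Theorem 1.1 (proof)] -/
theorem depthReduction (n T : ℕ) (hΔ : 1 ≤ Δ) (hn : 2 * Δ ≤ n) (L : ℕ) :
    ∀ {ι : Type} [Fintype ι] (A : ι → Comp σ K Δ), (∀ i, (A i).D ≤ L) →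
      ∑ i, (A i).internal ≤ T →
      ∃ (r : ℕ) (ρ : Type) (_ : Fintype ρ) (P Q : ρ → MvPolynomial σ K) (c₀ : K)
        (ι' : Type) (_ : Fintype ι') (A' : ι' → Comp σ K Δ) (L' : ℕ),
        Fintype.card ρ = r ∧ (∀ i, (A' i).D ≤ L') ∧ L' * Δ < n ∧
        (∀ x, constantCoeff (P x) = 0) ∧ (∀ x, constantCoeff (Q x) = 0) ∧
        ∑ i, (A i).eval = ∑ i, (A' i).eval + ∑ x, P x * Q x + C c₀ ∧
        (L * Δ < n → r = 0) ∧
        (n ≤ L * Δ → r * (n / Δ - 1) * (L - 1) + 6 * T * (n / Δ - 1) ≤ 9 * T * (L - 1)) := by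
  induction L using Nat.strong_induction_on with
  | _ L ih =>
  intro ι _ A hAL hT
  classical
  by_cases hstop : L * Δ < n
  · refine ⟨0, PEmpty, inferInstance, PEmpty.elim, PEmpty.elim, 0, ι, inferInstance, A, L, by simp,
      hAL, hstop, fun x => x.elim, fun x => x.elim, by simp, fun _ => rfl,
      fun h => absurd hstop (not_lt.2 h)⟩
  have hstop' : n ≤ L * Δ := not_lt.1 hstop
  have hL2 : 2 ≤ L := by
    by_contra h
    have : L * Δ ≤ 1 * Δ := Nat.mul_le_mul_right _ (by omega)
    omega
  -- the cut layer: a window layer of minimal load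
  obtain ⟨j, hjW, hjmin⟩ := Finset.exists_min_image (window L) (load A) (window_nonempty hL2)
  obtain ⟨hj1, h3j, h3Lj, hjL⟩ := mem_window hjW
  have hload : load A j * (L - 1) ≤ 3 * T := by
    have h1 : (window L).card • load A j ≤ ∑ j' ∈ window L, load A j' :=
      Finset.card_nsmul_le_sum _ _ _ fun j' hj' => hjmin j' hj'
    rw [smul_eq_mul] at h1
    have h2 := sum_load_le A (window L) fun j' hj' => (mem_window hj').1
    calc load A j * (L - 1) ≤ load A j * (3 * (window L).card) :=
          Nat.mul_le_mul_left _ (three_mul_card_window L)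
      _ = 3 * ((window L).card * load A j) := by ring
      _ ≤ 3 * T := Nat.mul_le_mul_left _ (h1.trans (h2.trans hT))
  -- the new family and the induction hypothesis
  have h3L₁ : 3 * max j (L - j) ≤ 2 * L := by
    rcases le_total j (L - j) with h | h
    · rw [max_eq_right h]; exact h3Lj
    · rw [max_eq_left h]; exact h3j
  have hL₁L : max j (L - j) < L := by omega
  have hA₁L : ∀ x, (step A j hj1 x).D ≤ max j (L - j) := step_D_le A j hj1 hAL
  have hT₁ : ∑ x, (step A j hj1 x).internal ≤ T := by have := internal_step A j hj1; omega
  obtain ⟨r₁, ρ₁, _, P₁, Q₁, c₁, ι', _, A', L', hr₁, hA'L', hL'n, hP₁, hQ₁, hev₁, hstop₁, hgo₁⟩ :=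
    ih _ hL₁L (step A j hj1) hA₁L hT₁
  refine ⟨r₁ + load A j, ρ₁ ⊕ (Σ p : {i : ι // j < (A i).D}, ((A p.1).S j)), inferInstance,
    Sum.elim P₁ (fun x => (A x.1.1).errP j x.2.1), Sum.elim Q₁ (fun x => (A x.1.1).errQ j x.2.1),
    c₁ - ∑ p : {i : ι // j < (A i).D}, (A p.1).δ j, ι', inferInstance, A', L', ?_, hA'L', hL'n,
    ?_, ?_, ?_, fun h => absurd h hstop, fun _ => ?_⟩
  · -- the count of error terms
    rw [Fintype.card_sum, hr₁, Fintype.card_sigma]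
    simp only [Fintype.card_coe]
    rw [load, sum_subtype_eq_sum_ite (fun i => j < (A i).D) (fun i => ((A i).S j).card)]
  · rintro (x | x)
    · exact hP₁ x
    · exact (A x.1.1).constantCoeff_errP j x.2.1
  · rintro (x | x)
    · exact hQ₁ x
    · exact (A x.1.1).constantCoeff_errQ j x.2.1
  · -- the identity
    have hσ : ∑ x : (Σ p : {i : ι // j < (A i).D}, ((A p.1).S j)),
        (A x.1.1).errP j x.2.1 * (A x.1.1).errQ j x.2.1
        = ∑ p : {i : ι // j < (A i).D}, ∑ u ∈ (A p.1).S j, (A p.1).errP j u * (A p.1).errQ j u := by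
      rw [Fintype.sum_sigma]
      exact Finset.sum_congr rfl fun p _ =>
        (Finset.sum_subtype ((A p.1).S j) (fun _ => Iff.rfl)
          (fun u => (A p.1).errP j u * (A p.1).errQ j u)).symm
    rw [eval_step A j hj1, hev₁, Fintype.sum_sum_type, map_sub]
    simp only [Sum.elim_inl, Sum.elim_inr]
    rw [hσ]
    ring
  · -- the geometric bound
    by_cases h₁ : max j (L - j) * Δ < n
    · rw [hstop₁ h₁, zero_add]
      refine bound_last ?_ hload
      have : n / Δ ≤ L := Nat.div_le_of_le_mul (by rwa [mul_comm] at hstop')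
      omega
    · have hgo := hgo₁ (not_lt.1 h₁)
      have hL₁2 : 2 ≤ max j (L - j) := by
        by_contra h
        have : max j (L - j) * Δ ≤ 1 * Δ := Nat.mul_le_mul_right _ (by omega)
        omega
      rw [add_comm r₁]
      exact bound_step (e₁ := max j (L - j) - 1) (by omega) (by omega) hgo hload

end Reduction

/-! ### From Definition 1 (graph rendering) to a chain of matrices -/

section Convert

variable {K : Type*} [CommSemiring K] {n : ℕ}

/-- In a layered graph a walk of length `j` from `s` ends `j` layers above `s`.
[cite: ChatterjeeKumarSheVolk2022, Definition 1] -/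
theorem layer_eq_of_pow_apply_ne_zero {k : ℕ} {layer : Fin k → ℕ}
    {N : Matrix (Fin k) (Fin k) (MvPolynomial (Fin n) K)}
    (hlay : ∀ u v, N u v ≠ 0 → layer v = layer u + 1) (s : Fin k) :
    ∀ (j : ℕ) (u : Fin k), (N ^ j) s u ≠ 0 → layer u = layer s + j := by
  intro j
  induction j with
  | zero =>
    intro u h
    rw [pow_zero, Matrix.one_apply] at h
    by_cases hsu : s = u
    · rw [hsu, add_zero]
    · exact absurd (if_neg hsu) h
  | succ j ih =>
    intro u h
    rw [pow_succ, Matrix.mul_apply] at h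
    obtain ⟨w, -, hw⟩ := Finset.exists_ne_zero_of_sum_ne_zero h
    have h1 : (N ^ j) s w ≠ 0 := fun h0 => hw (by rw [h0, zero_mul])
    have h2 : N w u ≠ 0 := fun h0 => hw (by rw [h0, mul_zero])
    rw [hlay w u h2, ih w h1, add_assoc]

/-- **Def. 1 ⇒ the matrix rendering** (§1.1, p0004:L1–L6): a layered ABP on `k` vertices with labels
of degree `≤ Δ` whose end vertex lies `D ≥ 1` layers above the start is ONE component with `D`
matrices (layer `i` = the vertices `i` layers above `s`, the first and last layer cut down to `{s}`,
`{t}`), computing the same polynomial, with at most `k − 2` internal vertices.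
[cite: ChatterjeeKumarSheVolk2022, Definition 1, §1.1] -/
theorem exists_comp_of_layered {k Δ : ℕ} (layer : Fin k → ℕ) (s t : Fin k)
    (N : Matrix (Fin k) (Fin k) (MvPolynomial (Fin n) K))
    (hlay : ∀ u v, N u v ≠ 0 → layer v = layer u + 1) (hdeg : ∀ u v, (N u v).totalDegree ≤ Δ)
    (hD : 1 ≤ layer t - layer s) :
    ∃ c : Comp (Fin n) K Δ, c.D = layer t - layer s ∧
      c.eval = (N ^ (layer t - layer s)) s t ∧ c.internal + 2 ≤ k := by
  classical
  set D := layer t - layer s with hDdef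
  have hts : layer t = layer s + D := by omega
  -- layer supports and masked matrices
  let S : ℕ → Finset (Fin k) := fun i =>
    if i = 0 then {s} else if i = D then {t} else Finset.univ.filter fun v => layer v = layer s + i
  let M : ℕ → Matrix (Fin k) (Fin k) (MvPolynomial (Fin n) K) := fun i =>
    Matrix.of fun u v => if u ∈ S i ∧ v ∈ S (i + 1) then N u v else 0
  have hS0 : S 0 = {s} := by simp [S]
  have hSD : S D = {t} := by simp [S, show D ≠ 0 by omega]
  have hSmid : ∀ i, i ≠ 0 → i ≠ D → S i = Finset.univ.filter fun v => layer v = layer s + i := by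
    intro i h0 hD'; simp [S, h0, hD']
  refine ⟨{ k := k, s := s, t := t, D := D, one_le_D := hD, S := S, M := M, S_zero := hS0,
            S_D := hSD, supp := ?_, deg := ?_ }, rfl, ?_, ?_⟩
  · intro j u v h
    by_contra h'
    exact h (by simp only [M, Matrix.of_apply]; rw [if_neg h'])
  · intro j u v
    simp only [M, Matrix.of_apply]
    split_ifs
    · exact hdeg u v
    · rw [totalDegree_zero]; exact Nat.zero_le _
  · -- the computed polynomial
    -- (C) a walk of length `j < D` from `s` ends in `S j`
    have hC : ∀ j, j < D → ∀ u, (N ^ j) s u ≠ 0 → u ∈ S j := by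
      intro j hj u hu
      have hl := layer_eq_of_pow_apply_ne_zero hlay s j u hu
      by_cases hj0 : j = 0
      · subst hj0
        rw [pow_zero, Matrix.one_apply] at hu
        have : s = u := by by_contra hne; exact hu (if_neg hne)
        rw [hS0, ← this]; exact Finset.mem_singleton_self _
      · rw [hSmid j hj0 (by omega)]
        exact Finset.mem_filter.2 ⟨Finset.mem_univ _, hl⟩
    -- (A) row `s` of the chain agrees with row `s` of `N ^ j`
    have hA : ∀ j, j ≤ D → ∀ v, (j < D ∨ v = t) → chainProd M 0 j s v = (N ^ j) s v := by
      intro j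
      induction j with
      | zero => intro _ v _; rw [chainProd_zero, pow_zero]
      | succ j ih =>
        intro hj v hv
        rw [chainProd_succ, zero_add, Matrix.mul_apply, pow_succ, Matrix.mul_apply]
        refine Finset.sum_congr rfl fun w _ => ?_
        rw [ih (by omega) w (Or.inl (by omega))]
        by_cases hw : (N ^ j) s w = 0
        · rw [hw, zero_mul, zero_mul]
        congr 1
        simp only [M, Matrix.of_apply]
        by_cases hNwv : N w v = 0
        · rw [hNwv, ite_self]
        rw [if_pos]
        refine ⟨hC j (by omega) w hw, ?_⟩
        have hlv : layer v = layer s + (j + 1) := by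
          rw [hlay w v hNwv, layer_eq_of_pow_apply_ne_zero hlay s j w hw, add_assoc]
        rcases hv with hv | hv
        · rw [hSmid (j + 1) (by omega) (by omega)]
          exact Finset.mem_filter.2 ⟨Finset.mem_univ _, hlv⟩
        · subst hv
          rw [show j + 1 = D by omega, hSD]
          exact Finset.mem_singleton_self _
    exact hA D le_rfl t (Or.inr rfl)
  · -- the vertex count: the internal layers are disjoint and avoid `s`, `t`
    show (∑ i ∈ Finset.Ico 1 D, (S i).card) + 2 ≤ k
    have hst : s ≠ t := by
      intro h; rw [h] at hts; omega
    have h1 : ∑ i ∈ Finset.Ico 1 D, (S i).card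
        = ((Finset.Ico 1 D).biUnion S).card := by
      rw [Finset.card_biUnion]
      intro x hx y hy hxy
      have hx' := Finset.mem_Ico.1 (Finset.mem_coe.1 hx)
      have hy' := Finset.mem_Ico.1 (Finset.mem_coe.1 hy)
      show Disjoint (S x) (S y)
      rw [hSmid x (by omega) (by omega), hSmid y (by omega) (by omega)]
      exact Finset.disjoint_filter.2 fun v _ h1 h2 => hxy (by omega)
    have h2 : (Finset.Ico 1 D).biUnion S ⊆ Finset.univ \ {s, t} := by
      intro v hv
      rw [Finset.mem_biUnion] at hv
      obtain ⟨i, hi, hvi⟩ := hv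
      rw [Finset.mem_Ico] at hi
      rw [hSmid i (by omega) (by omega), Finset.mem_filter] at hvi
      rw [Finset.mem_sdiff, Finset.mem_insert, Finset.mem_singleton]
      refine ⟨Finset.mem_univ _, ?_⟩
      rintro (rfl | rfl) <;> omega
    have h3 := Finset.card_le_card h2
    rw [Finset.card_univ_sdiff, Fintype.card_fin, Finset.card_pair hst] at h3
    have h4 : 2 ≤ k := by
      have := Finset.card_le_univ ({s, t} : Finset (Fin k))
      rw [Finset.card_pair hst, Fintype.card_fin] at this
      exact this
    omega

end Convert

end CKSV2022

/-! ### Theorem 1.1 -/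

section Main

variable {K : Type*} [Field K]

open CKSV2022 in
/-- **Chatterjee–Kumar–She–Volk 2022, Theorem 1.1** (p0004: "Let `𝔽` be a field and `n ∈ ℕ` such
that `char(𝔽) ∤ n`. Then any algebraic branching program over `𝔽` computing the polynomial
`Σ_{i=1}^n x_i^n` is of size at least `Ω(n²)`. When the ABP's edge labels are allowed to be
polynomials of degree at most `Δ`, our lower bound is `Ω(n²/Δ)`."), PROVED with an explicit constant:
a layered ABP (Def. 1) on at most `m` vertices with edge labels of degree `≤ Δ` computing
`Σ_{i<n} x_i^n` over a field with `(n : K) ≠ 0` satisfies `n·(⌊n/Δ⌋ − 1) ≤ 18·(m − 2)`, i.e.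
`m ≥ 2 + n(⌊n/Δ⌋ − 1)/18 = Ω(n²/Δ)` (the printed proof: `m ≥ 0.001·n²/Δ`, with the harmless extra
hypothesis `Δ ≤ n/10`; for `n < 2Δ` the left side here is `0`). Proof = §3.2 (module docstring):
depth reduction `CKSV2022.depthReduction` from the one-component rendering
`CKSV2022.exists_comp_of_layered`, then the width lemma `KumarVolk.width_lemma_zero` (= Lemma 8 with
`m = 0`) on `Σ x_i^n = Σ_{x<r} P_x Q_x + (F' + c₀)`, `deg(F' + c₀) < n`, giving `n ≤ 2r ≤ 18(m−2)/q`.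
[cite: ChatterjeeKumarSheVolk2022, Theorem 1.1] -/
theorem chatterjeeKumarSheVolk2022_thm_1_1 {n m Δ : ℕ} (hnK : (n : K) ≠ 0)
    (h : LayeredABPDegComputes m Δ (psum (Fin n) K n)) : n * (n / Δ - 1) ≤ 18 * (m - 2) := by
  classical
  by_cases hsmall' : n / Δ ≤ 1
  · rw [show n / Δ - 1 = 0 by omega, mul_zero]; exact Nat.zero_le _
  have hsmall : 1 < n / Δ := not_le.1 hsmall'
  have hΔ : 1 ≤ Δ := by
    rcases Nat.eq_zero_or_pos Δ with h0 | h0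
    · rw [h0, Nat.div_zero] at hsmall; omega
    · exact h0
  have hn : 2 * Δ ≤ n := by
    have h1 := Nat.div_mul_le_self n Δ
    have h2 : 2 * Δ ≤ n / Δ * Δ := Nat.mul_le_mul_right _ hsmall
    omega
  have hn2 : 2 ≤ n := by omega
  obtain ⟨k, hk, layer, s, t, N, hlay, hdeg, hcomp⟩ := h
  -- the end vertex lies `D ≥ 1` layers above the start (else the computed polynomial is constant)
  have hD : 1 ≤ layer t - layer s := by
    by_contra h0
    rw [show layer t - layer s = 0 by omega, pow_zero] at hcomp
    have h1 : (psum (Fin n) K n).totalDegree = 0 := by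
      rw [← hcomp, Matrix.one_apply]
      split_ifs
      · exact totalDegree_one
      · exact totalDegree_zero
    rw [KumarVolk.totalDegree_psum (by omega) (by omega)] at h1
    omega
  obtain ⟨c, hcD, hc, hck⟩ := exists_comp_of_layered layer s t N hlay hdeg hD
  rw [hcomp] at hc
  -- depth reduction of the one-component multilayered ABP
  obtain ⟨r, ρ, _, P, Q, c₀, ι', _, A', L', hr, hA'L', hL'n, hP, hQ, hev, hstop, hgo⟩ :=
    depthReduction (σ := Fin n) (K := K) n c.internal hΔ hn c.D (ι := Unit) (fun _ => c)
      (fun _ => le_rfl) (by simp)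
  -- the width lemma (Lemma 8 with no `P_i Q_i`): `n ≤ 2r`
  have hwidth : n ≤ 2 * r := by
    have hP' : (∑ i, (A' i).eval + C c₀).totalDegree < n := by
      refine lt_of_le_of_lt (totalDegree_add _ _) (max_lt ?_ ?_)
      · exact lt_of_le_of_lt (totalDegree_finsetSum _ _) (lt_of_le_of_lt (Finset.sup_le fun i _ =>
          ((A' i).totalDegree_eval_le.trans (Nat.mul_le_mul_right _ (hA'L' i)))) hL'n)
      · rw [totalDegree_C]; omega
    have key : psum (Fin n) K n = ∑ x, P x * Q x + (∑ i, (A' i).eval + C c₀) := by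
      rw [← hc]
      have h1 : ∑ _i : Unit, c.eval = c.eval := by simp
      rw [h1] at hev
      rw [hev]; ring
    rw [← hr]
    exact KumarVolk.width_lemma_zero hn2 hnK P Q hP hQ _ hP' key
  -- the error count
  by_cases hDn : c.D * Δ < n
  · have := hstop hDn; omega
  · have hgo' := hgo (not_lt.1 hDn)
    have hD2 : 2 ≤ c.D := by
      by_contra h0
      have : c.D * Δ ≤ 1 * Δ := Nat.mul_le_mul_right _ (by omega)
      omega
    have h1 : r * (n / Δ - 1) * (c.D - 1) ≤ 9 * c.internal * (c.D - 1) :=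
      le_trans (Nat.le_add_right _ _) hgo'
    have h2 : r * (n / Δ - 1) ≤ 9 * c.internal := Nat.le_of_mul_le_mul_right h1 (by omega)
    have h3 : c.internal ≤ m - 2 := by omega
    calc n * (n / Δ - 1) ≤ 2 * r * (n / Δ - 1) := Nat.mul_le_mul_right _ hwidth
      _ = 2 * (r * (n / Δ - 1)) := by ring
      _ ≤ 2 * (9 * c.internal) := Nat.mul_le_mul_left _ h2
      _ = 18 * c.internal := by ring
      _ ≤ 18 * (m - 2) := Nat.mul_le_mul_left _ h3

/-- **Theorem 1.1, affine labels** (the headline case `Δ = 1` of Def. 1: "each edge is labeled by an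
affine linear form"): a layered ABP on at most `m` vertices computing `Σ_{i<n} x_i^n` over a field
with `(n : K) ≠ 0` has `n(n−1) ≤ 18(m−2)`, i.e. `m ≥ 2 + n(n−1)/18 = Ω(n²)` vertices. The hypothesis
is the tree's `LayeredABPComputes` (Andrews–Forbes rendering of the same notion).
[cite: ChatterjeeKumarSheVolk2022, Theorem 1.1] -/
theorem chatterjeeKumarSheVolk2022_thm_1_1_affine {n m : ℕ} (hnK : (n : K) ≠ 0)
    (h : LayeredABPComputes m (psum (Fin n) K n)) : n * (n - 1) ≤ 18 * (m - 2) := by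
  have := chatterjeeKumarSheVolk2022_thm_1_1 hnK
    ((layeredABPComputes_iff_layeredABPDegComputes_one m _).1 h)
  rwa [Nat.div_one] at this


/-- **Chatterjee–Kumar–She–Volk 2022, Lemma 8** (§3.1, p0009: "Let `n ∈ ℕ`, and let `𝔽` be an
algebraically closed field such that `char(𝔽) ∤ n`. Let `{P_1,…,P_m, Q_1,…,Q_m, A_1,…,A_r, B_1,…,B_r}`
be a set of polynomials … such that the set of their common zeros `V = 𝕍(P_1,…,Q_m,A_1,…,B_r)` is
non-empty. Finally, suppose `R` is a polynomial … of degree at most `n−1`, such that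
`Σ_{i=1}^n x_i^n + Σ_j A_j·B_j = R + Σ_i P_i·Q_i`. Then, `m ≥ n/2 − r`." — "a slight generalization of
Lemma 3.1 in [K19]"), PROVED over any field with `(n : K) ≠ 0`, the non-emptiness of `V` rendered by a
common zero `a` (over an algebraically closed field the two are the same datum), as `n ≤ 2m + 2r`: it is
the width lemma `KumarVolk.width_lemma` (Kumar–Volk 2022 Lemma 4 = [CKSV19, K19]) applied to the
`m + r` pairs `(P_i, Q_i), (A_j, −B_j)`. The `m = 0` case is the endgame of
`chatterjeeKumarSheVolk2022_thm_1_1` above. [cite: ChatterjeeKumarSheVolk2022, Lemma 8] -/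
theorem chatterjeeKumarSheVolk2022_lemma_8 {n : ℕ} (hn : 2 ≤ n) (hnK : (n : K) ≠ 0)
    {ι ι' : Type*} [Fintype ι] [Fintype ι'] (P Q : ι → MvPolynomial (Fin n) K)
    (A B : ι' → MvPolynomial (Fin n) K) (R : MvPolynomial (Fin n) K) (hR : R.totalDegree < n)
    (a : Fin n → K) (haP : ∀ i, MvPolynomial.eval a (P i) = 0 ∧ MvPolynomial.eval a (Q i) = 0)
    (haA : ∀ j, MvPolynomial.eval a (A j) = 0 ∧ MvPolynomial.eval a (B j) = 0)
    (h : psum (Fin n) K n + ∑ j, A j * B j = R + ∑ i, P i * Q i) :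
    n ≤ 2 * Fintype.card ι + 2 * Fintype.card ι' := by
  have key : psum (Fin n) K n
      = ∑ x : ι ⊕ ι', Sum.elim P A x * Sum.elim Q (fun j => -B j) x + R := by
    rw [Fintype.sum_sum_type]
    simp only [Sum.elim_inl, Sum.elim_inr, mul_neg, Finset.sum_neg_distrib]
    rw [← sub_eq_add_neg]
    rw [eq_comm, ← sub_eq_iff_eq_add] at h
    rw [← h]
    ring
  have := KumarVolk.width_lemma hn hnK (Sum.elim P A) (Sum.elim Q fun j => -B j) R hR a
    (by rintro (i | j)
        · exact haP i
        · exact ⟨(haA j).1, by rw [Sum.elim_inr, map_neg, (haA j).2, neg_zero]⟩) key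
  rw [Fintype.card_sum] at this
  omega

/-- **Chatterjee–Kumar–She–Volk 2022, Claim 9** (§3.1, p0009, "Lemma 3.2 in [K19]": "Let `𝔽` be
an algebraically closed field, and `D` a positive natural number. For every choice of polynomials
`g_1, g_2, …, g_n ∈ 𝔽[x]` of degree at most `D−1`, the dimension of the variety
`𝕍(x_1^D − g_1, x_2^D − g_2, …, x_n^D − g_n)` is zero."), PROVED in the algebraic form that carries the
content over any field: the coordinate ring `K[x]/(x_i^D − g_i : i)` is a finite-dimensional
`K`-vector space (so the ideal is zero-dimensional and the variety is a finite set of points) — it is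
spanned by the monomials with all exponents `< D`, the tree's
`KumarVolk.moduleFinite_quotient_of_pow_sub_mem`. [cite: ChatterjeeKumarSheVolk2022, Claim 9] -/
theorem chatterjeeKumarSheVolk2022_claim_9 {n D : ℕ} (hD : 0 < D) (g : Fin n → MvPolynomial (Fin n) K)
    (hg : ∀ i, (g i).totalDegree ≤ D - 1) :
    Module.Finite K (MvPolynomial (Fin n) K ⧸ Ideal.span (Set.range fun i => X i ^ D - g i)) := by
  obtain ⟨e, rfl⟩ : ∃ e, D = e + 1 := ⟨D - 1, by omega⟩
  exact KumarVolk.moduleFinite_quotient_of_pow_sub_mem _ g (fun i => by simpa using hg i)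
    fun i => Ideal.subset_span ⟨i, rfl⟩

open CKSV2022 in
/-- **Theorem 1.1 in the generality of its printed proof: multilayered ABPs** (§3.2, p0012: "Let `𝒜`
be a multilayered ABP with `d_0` layers which computes the polynomial `Σ_{i=1}^n x_i^n` … we apply
Claim 13 iteratively … `τ ≥ |𝒜'| ≥ (n/2 − r)·n/(2Δ) = Ω(n²/Δ)`"; Def. 5: a multilayered ABP is a family
of layered ABPs sharing start and end vertex, computing the sum, of size `2 + Σ_i (τ_i − 2)`): for a
finite family of layered components with labels of degree `≤ Δ` computing `Σ_{i<n} x_i^n` over a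
field with `(n : K) ≠ 0`, `n·(⌊n/Δ⌋ − 1) ≤ 18·Σ_i internal_i = 18·(size − 2)`.
[cite: ChatterjeeKumarSheVolk2022, Theorem 1.1 (proof), Definition 5] -/
theorem chatterjeeKumarSheVolk2022_thm_1_1_multilayered {n Δ : ℕ} (hnK : (n : K) ≠ 0)
    {ι : Type} [Fintype ι] (A : ι → CKSV2022.Comp (Fin n) K Δ)
    (hA : ∑ i, (A i).eval = psum (Fin n) K n) :
    n * (n / Δ - 1) ≤ 18 * ∑ i, (A i).internal := by
  classical
  by_cases hsmall' : n / Δ ≤ 1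
  · rw [show n / Δ - 1 = 0 by omega, mul_zero]; exact Nat.zero_le _
  have hsmall : 1 < n / Δ := not_le.1 hsmall'
  have hΔ : 1 ≤ Δ := by
    rcases Nat.eq_zero_or_pos Δ with h0 | h0
    · rw [h0, Nat.div_zero] at hsmall; omega
    · exact h0
  have hn : 2 * Δ ≤ n := by
    have h1 := Nat.div_mul_le_self n Δ
    have h2 : 2 * Δ ≤ n / Δ * Δ := Nat.mul_le_mul_right _ hsmall
    omega
  have hn2 : 2 ≤ n := by omega
  -- a common bound on the number of matrices
  set L := Finset.univ.sup fun i => (A i).D with hL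
  have hAL : ∀ i, (A i).D ≤ L := fun i => Finset.le_sup (f := fun i => (A i).D) (Finset.mem_univ i)
  obtain ⟨r, ρ, _, P, Q, c₀, ι', _, A', L', hr, hA'L', hL'n, hP, hQ, hev, hstop, hgo⟩ :=
    depthReduction (σ := Fin n) (K := K) n (∑ i, (A i).internal) hΔ hn L A hAL le_rfl
  -- the width lemma: `n ≤ 2r`
  have hwidth : n ≤ 2 * r := by
    have hP' : (∑ i, (A' i).eval + C c₀).totalDegree < n := by
      refine lt_of_le_of_lt (totalDegree_add _ _) (max_lt ?_ ?_)
      · exact lt_of_le_of_lt (totalDegree_finsetSum _ _) (lt_of_le_of_lt (Finset.sup_le fun i _ =>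
          ((A' i).totalDegree_eval_le.trans (Nat.mul_le_mul_right _ (hA'L' i)))) hL'n)
      · rw [totalDegree_C]; omega
    have key : psum (Fin n) K n = ∑ x, P x * Q x + (∑ i, (A' i).eval + C c₀) := by
      rw [← hA, hev]; ring
    rw [← hr]
    exact KumarVolk.width_lemma_zero hn2 hnK P Q hP hQ _ hP' key
  by_cases hLn : L * Δ < n
  · have := hstop hLn; omega
  · have hgo' := hgo (not_lt.1 hLn)
    have hL2 : 2 ≤ L := by
      by_contra h0
      have : L * Δ ≤ 1 * Δ := Nat.mul_le_mul_right _ (by omega)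
      omega
    have h1 : r * (n / Δ - 1) * (L - 1) ≤ 9 * (∑ i, (A i).internal) * (L - 1) :=
      le_trans (Nat.le_add_right _ _) hgo'
    have h2 : r * (n / Δ - 1) ≤ 9 * ∑ i, (A i).internal := Nat.le_of_mul_le_mul_right h1 (by omega)
    calc n * (n / Δ - 1) ≤ 2 * r * (n / Δ - 1) := Nat.mul_le_mul_right _ hwidth
      _ = 2 * (r * (n / Δ - 1)) := by ring
      _ ≤ 2 * (9 * ∑ i, (A i).internal) := Nat.mul_le_mul_left _ h2
      _ = 18 * ∑ i, (A i).internal := by ring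

end Main

end Literature.Computability.AlgebraicComplexity
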